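import Summits.CriticalPhenomena.PercolationContinuityZ3.Theses.PercLowPointHalfSpace
import Literature.Probability.Percolation.CubicCriticalProbHalfProofs

/-!
# `PercLowPointHalfSpace.FloorSubcritical` (stmt-CriticalPhenomena-1337): `p_c^bond(ℤ³) < 1/2`

Route `route-CriticalPhenomena-PercLowPointHalfSpace`, support item `FloorSubcritical`:
the floor plane `{x₀ = 0}` of the half-space `H ⊆ ℤ³` carries two-dimensional bond percolation at
parameter `p_c(ℤ³)`, and the route's bookkeeping step needs it STRICTLY subcritical, i.e.
`p_c^bond(ℤ³) < 1/2 = p_c^bond(ℤ²)`.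

The statement is literally the named fact
`Literature.Probability.Percolation.kesten_criticalProb_Z3_lt_half`
(Kesten, *Percolation Theory for Mathematicians* (1982), §10.2, Example (iii), display following
(10.30); `Literature/Probability/Percolation/CubicCriticalProbHalf.lean`), which is DISCHARGED in
the tree by `kesten_criticalProb_Z3_lt_half_holds`
(`Literature/Probability/Percolation/CubicCriticalProbHalfProofs.lean`: the van den Berg–Frieze
ladder coupling recorded by Grimmett, *Percolation* (1999), notes to §1.4, p. 30, truncated at
height one, giving `p_c(ℤ³) ≤ 24/49 < 1/2` from Kesten's `p_c(ℤ²) = 1/2`). So the item closes by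
`exact`; the result is unconditional (no named-fact hypothesis).
-/

namespace Summit.CriticalPhenomena.PercolationContinuityZ3.Theorems

/-- Settles `stmt-CriticalPhenomena-1337` (exact route decl `PercLowPointHalfSpace.FloorSubcritical`):
the bond percolation threshold of the cubic lattice is strictly below one half,
`criticalProb (zdGraph 3) 0 < 1/2` — Kesten (1982), §10.2, Example (iii); proved in the tree as
`Literature.Probability.Percolation.kesten_criticalProb_Z3_lt_half_holds` (van den Berg–Frieze
ladders, Grimmett 1999, notes to §1.4, p. 30). [folklore] -/
theorem floorSubcritical_proof :
    Summit.CriticalPhenomena.PercolationContinuityZ3.Theses.PercLowPointHalfSpace.FloorSubcritical := by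
  unfold Summit.CriticalPhenomena.PercolationContinuityZ3.Theses.PercLowPointHalfSpace.FloorSubcritical
  exact Literature.Probability.Percolation.kesten_criticalProb_Z3_lt_half_holds

end Summit.CriticalPhenomena.PercolationContinuityZ3.Theorems
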